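import Summits.Parity.GeneralizedHardyLittlewood.Theorems.Dhl42MainTerms
import Summits.Parity.GeneralizedHardyLittlewood.Theorems.Dhl42DefsCover

/-!
# DHL[42,2] certificate — the certificate value `M ≥ 3.84176 > 2/θ` with kernel-checked main terms (eq. (32))

The certificate arithmetic of §7.2, eq. (30)–(32), over the tree's copies of the functionals: (A)
the closed forms of the two main terms as the INEQUALITIES the arithmetic consumes,
`JKClosedForm : jkSum ≤ 42·J^K(F₀)` and `IClosedForm : I(F₀) ≤ iSum` (proved in `Dhl42ClosedForm`;
kept as named `Prop`s so that the arithmetic is stated once, hypothesis-explicitly), and the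
certificate inputs C1, C2 from them and the kernel enclosures `jkSum_lb`, `iSum_ub`; (B) the
certificate value `Mcert = (jkSum − 24124586.5 − 16418728.9)/iSum ≥ 3.84176` (`M_ge`, kernel
numerics + `norm_num`), `2/θ = 10⁶/260571 < 3.84176` (`two_div_theta_lt`), and the same bound for
the paper's functionals under the loss bounds C3 (`42·Σ L_G ≤ 24124586.5`) and C4
(`2·Σ√(AB) ≤ 16418728.9`) of eq. (31) (`sieveRatio_ge`). The deduction of
`WeakDicksonHardyLittlewood 42 2` from these numbers is the headline file (batch B5); the package's
axiom-closed variants (its Part D, `namespace Assumed`) are not migrated.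

Origin: `Dhl42/Certificate.lean` of the DHL[42,2] certificate package (pub-dhl42 bundle, archive
blob `18cce9e3`; sha256[:16] of the file `415c8a6eb26193a0`; paper snapshot = `paper/main.tex` v1),
lines :46–:110; statements and proofs unchanged except: namespace `TpY4Dhl42` (with `open Dhl42`) →
`Summit.Parity.GeneralizedHardyLittlewood.Theorems.Dhl42` (the certificate's Part 1–7 declarations
and `jkSum`, `iSum`, … live there after batches B2–B4a), docstrings added where missing (the
docstrings of `JKClosedForm`, `IClosedForm`, `JK_certified_of_closedForm`,
`I_certified_of_closedForm`, `kLGbound`, `twoXbound` re-worded for the tree: package-internal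
pointers removed, mathematics unchanged).

Declarations (11): `JKClosedForm`, `IClosedForm`, `JK_certified_of_closedForm`,
`I_certified_of_closedForm`, `kLGbound`, `twoXbound`, `Mcert`, `M_ge`, `two_div_theta_lt`,
`two_div_theta_lt_Mcert`, `sieveRatio_ge`.
-/

namespace Summit.Parity.GeneralizedHardyLittlewood.Theorems.Dhl42

/-! ## A. The closed-form (analytic) halves of the certificate inputs C1 and C2 -/

/-- **Closed form of `42·J^K(F₀)`, as the inequality the certificate consumes** (analytic half of
input C1): the exact value `jkSum ∈ ℚ[e^ℚ]` (`Dhl42MainTermsData`, 113 terms) is at most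
`42·J^K(F₀)`. Paper: Lemma 6.1(c) and §6.3 give equality — proved in this directory as
`JKval42_eq_jkSum` (`Dhl42ClosedForm`), whence `JK_closedForm_thm : JKClosedForm`. -/
def JKClosedForm : Prop := jkSum ≤ 42 * JKval

/-- **Closed form of `I(F₀)`, as the inequality the certificate consumes** (analytic half of input
C2): `I(F₀)` is at most the exact value `iSum ∈ ℚ[e^ℚ]` (`Dhl42MainTermsData`, 23 terms). Paper:
Lemma 6.1(b) and §6.3 give equality — proved as `Ival_eq_iSum` (`Dhl42ClosedForm`), whence
`I_closedForm_thm : IClosedForm`. -/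
def IClosedForm : Prop := Ival ≤ iSum

/-- Input C1, `16594281924.53 ≤ 42·J^K(F₀)`, from its analytic half; the numerical half
`16594281924.53 ≤ jkSum` is the kernel enclosure `jkSum_lb` (`Dhl42MainTerms`). -/
theorem JK_certified_of_closedForm (h : JKClosedForm) : (16594281924.53 : ℝ) ≤ 42 * JKval :=
  le_trans jkSum_lb h

/-- Input C2, `I(F₀) ≤ 4308892660.35`, from its analytic half; the numerical half
`iSum ≤ 4308892660.35` is the kernel enclosure `iSum_ub` (`Dhl42MainTerms`). -/
theorem I_certified_of_closedForm (h : IClosedForm) : Ival ≤ 4308892660.35 :=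
  le_trans h iSum_ub

/-! ## B. The certificate value `M ≥ 3.84176 > 2/θ` (paper, eq. (32) `eq:concl42`) -/

/-- The certified bound of eq. (31) on the total large-divisor loss, `42·Σ L_G ≤ 24124586.5` (input
C3), as a constant. -/
noncomputable def kLGbound : ℝ := 24124586.5

/-- The certified bound of eq. (31) on the total cross term, `2·Σ√(A B) ≤ 16418728.9` (input C4), as
a constant. -/
noncomputable def twoXbound : ℝ := 16418728.9

/-- The certificate value of the sieve functional: exact main terms, certified loss bounds. -/
noncomputable def Mcert : ℝ := (jkSum - kLGbound - twoXbound) / iSum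

/-- **`M ≥ 3.84176`** — eq. (32) of the paper with the main terms evaluated by the Lean kernel:
`(42·J^K(F₀) − 24124586.5 − 16418728.9) / I(F₀) ≥ 3.84176` for the closed forms.  (Exact value of
the left side with the kernel enclosures: `3.8417616575761…`; with the rounded main terms of eq. (30),
`16553738609.13 / 4308892660.35 = 3.8417616575729…`.) -/
theorem M_ge : (3.84176 : ℝ) ≤ Mcert := by
  unfold Mcert kLGbound twoXbound
  rw [le_div_iff₀ iSum_pos]
  have h1 := jkSum_lb
  have h2 := iSum_ub
  norm_num at h1 h2 ⊢
  linarith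

/-- `2/θ = 10⁶/260571 = 3.8377256… < 3.84176` (`θ = 1/2 + 2ϖ₃`, `ϖ₃ = 10571/10⁶`). -/
theorem two_div_theta_lt : 2 / theta < (3.84176 : ℝ) := by
  rw [theta_eq]; norm_num

/-- Hence the certificate inequality of Corollary 6.4 in ratio form: `2/θ < M`. -/
theorem two_div_theta_lt_Mcert : 2 / theta < Mcert := lt_of_lt_of_le two_div_theta_lt M_ge

/-- The same bound for the paper's functionals themselves: under the closed-form hypotheses, for any
bin families `bf` obeying the cross-term bound C4 and given C3,
`(42·J^K(F₀) − 42·L_G − 2·Σ√(AB)) / I(F₀) ≥ 3.84176` provided `I(F₀) > 0`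
(eq. (32) verbatim; positivity of `I(F₀) = ∫ F₀²` is immediate on paper and is assumed here only to
state the quotient — the deduction of DHL[42,2] below uses the division-free form). -/
theorem sieveRatio_ge (hJK : JKClosedForm) (hI : IClosedForm) (hIpos : 0 < Ival)
    (hLG : 42 * LGval ≤ 24124586.5) (bf : ∀ m : Member, MemberBins (memberTau0 m))
    (hX : 2 * totalCross bf ≤ 16418728.9) :
    (3.84176 : ℝ) ≤ (42 * JKval - 42 * LGval - 2 * totalCross bf) / Ival := by
  rw [le_div_iff₀ hIpos]
  have h1 := JK_certified_of_closedForm hJK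
  have h2 := I_certified_of_closedForm hI
  norm_num at h1 h2 hLG hX ⊢
  nlinarith

end Summit.Parity.GeneralizedHardyLittlewood.Theorems.Dhl42
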